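import Summits.CriticalPhenomena.PercolationContinuityZ3.Theorems.PercNearOneGluingNoHeavyLowerTailAPLGeometricAll
import HarnessLib

/-!
# `NoHeavyLowerTail` (stmt-CriticalPhenomena-4575) — the Gladkov–Zimin Conjecture 6.2, verbatim, for every finite weighted graph

Support file (prover prim-ineq-gen-8 gen 38; `--supports stmt-CriticalPhenomena-4575`; memo
run/shared/lean/prim/prim-ineq-gen-8/FINDING-gen38-APLG-ALL.md COROLLARY 3).  No definitions, no named facts, no sorries.

Gladkov–Zimin (*Bond percolation does not simulate site percolation*, Electron. Commun. Probab. 31 (2026), arXiv:2404.08873) pose two conjectures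
"increasing in strength": 6.2 — `∀ ε > 0 ∃ δ > 0: P(ab|c) < δ ∧ P(ac|b) < δ ⟹ P(abc) < ε ∨ P(a|b|c) < ε` — and 6.3 (`…APLGeometricAll.gladkovZimin_conjecture_6_3`).
Both follow from APL-G for every finite weighted graph (`aplG_all`); here is 6.2 with the explicit `δ = ε²/3`:
`P(a|b|c)·P(abc) ≤ (P(ab|c)+P(ac|b))·P(a|bc) + sqrt(P(ab|c)P(ac|b)) < 3δ = ε²` (`gz62_all`), so the smaller of the two factors is `< ε`.
* **`gladkovZimin_conjecture_6_2`**. [this work]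
-/

noncomputable section

namespace Summit.CriticalPhenomena.PercolationContinuityZ3.Theorems

namespace APL

open MeasureTheory Set Literature.Probability.Percolation Literature.Probability.LatticeModels
open scoped Classical

universe u

/-- **The Gladkov–Zimin Conjecture 6.2, verbatim** (arXiv:2404.08873, Conj. 6.2), for EVERY finite weighted graph, with `δ = ε²/3` uniformly:
`P(ab|c) < δ ∧ P(ac|b) < δ ⟹ P(a↔b, a↔c) < ε ∨ P(a|b|c) < ε`. [this work] -/
theorem gladkovZimin_conjecture_6_2 (ε : ℝ) (hε : 0 < ε) :
    ∃ δ : ℝ, 0 < δ ∧ ∀ (W : Type u) [Fintype W] (w : Sym2 W → unitInterval) (a b c : W),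
      (prodBernoulli w).real (openConn a b ∩ (openConn a c)ᶜ : Set (BondConfig W)) < δ →
      (prodBernoulli w).real (openConn a c ∩ (openConn a b)ᶜ : Set (BondConfig W)) < δ →
        (prodBernoulli w).real (openConn a b ∩ openConn a c : Set (BondConfig W)) < ε ∨
          (prodBernoulli w).real ((openConn a b)ᶜ ∩ (openConn a c)ᶜ ∩ (openConn b c)ᶜ : Set (BondConfig W)) < ε := by
  refine ⟨ε ^ 2 / 3, by positivity, ?_⟩
  intro V _ w a b c hab hac
  have h := gz62_all w a b c
  set u0 := (prodBernoulli w).real ((openConn a b)ᶜ ∩ (openConn a c)ᶜ ∩ (openConn b c)ᶜ : Set (BondConfig V)) with hu0def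
  set uab := (prodBernoulli w).real (openConn a b ∩ (openConn a c)ᶜ : Set (BondConfig V)) with huabdef
  set uac := (prodBernoulli w).real (openConn a c ∩ (openConn a b)ᶜ : Set (BondConfig V)) with huacdef
  set ubc := (prodBernoulli w).real ((openConn a b)ᶜ ∩ (openConn a c)ᶜ ∩ openConn b c : Set (BondConfig V)) with hubcdef
  set u3 := (prodBernoulli w).real (openConn a b ∩ openConn a c : Set (BondConfig V)) with hu3def
  have hu0 : 0 ≤ u0 := measureReal_nonneg
  have huab : 0 ≤ uab := measureReal_nonneg
  have huac : 0 ≤ uac := measureReal_nonneg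
  have hubc1 : ubc ≤ 1 := measureReal_le_one
  have hubc : 0 ≤ ubc := measureReal_nonneg
  have hu3 : 0 ≤ u3 := measureReal_nonneg
  -- `sqrt(uab·uac) < δ` and `(uab+uac)·ubc < 2δ`, so `u0·u3 < 3δ = ε²`
  have hs : Real.sqrt (uab * uac) < ε ^ 2 / 3 := by
    have hprod : uab * uac < (ε ^ 2 / 3) ^ 2 := by
      have h1 : uab * uac ≤ uab * (ε ^ 2 / 3) := mul_le_mul_of_nonneg_left hac.le huab
      have h2 : uab * (ε ^ 2 / 3) < ε ^ 2 / 3 * (ε ^ 2 / 3) := mul_lt_mul_of_pos_right hab (by positivity)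
      nlinarith
    calc Real.sqrt (uab * uac) < Real.sqrt ((ε ^ 2 / 3) ^ 2) := Real.sqrt_lt_sqrt (mul_nonneg huab huac) hprod
      _ = ε ^ 2 / 3 := Real.sqrt_sq (by positivity)
  have hprod : u0 * u3 < ε ^ 2 := by
    have : (uab + uac) * ubc ≤ uab + uac := by nlinarith
    nlinarith
  by_contra hcon
  push Not at hcon
  obtain ⟨h3, h0⟩ := hcon
  have : ε ^ 2 ≤ u0 * u3 := by nlinarith [mul_le_mul h0 h3 hε.le hu0]
  linarith

end APL

end Summit.CriticalPhenomena.PercolationContinuityZ3.Theorems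

end
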